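import Summits.CriticalPhenomena.CardyFormulaZ2.Theses.CardyRotToConf
import Literature.Probability.RandomPlanarGeometry.SLEDomainMarkov
import HarnessLib

/-!
# Stub `stub_isDomainMarkov` of line `germ-label-transport` (crux `stmt-CriticalPhenomena-0698`)

The typed domain Markov property (`ChordalFamily.IsDomainMarkov`) of any family of chordal SLE₆
laws on Dobrushin domains: the registered stub signature
`∀ Q : ChordalFamily, (∀ D : DobrushinDomain, IsSLELaw 6 D (Q D)) → Q.IsDomainMarkov`,
an instance of the Literature theorem `ChordalFamily.isDomainMarkov_of_isSLELaw` (every `κ > 0`;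
Markov extension `sleMarkovKernel κ`: Werner 2007 §3.2 (2) — strong Markov property of the
driving Brownian motion at the hitting times of closed sets by the trace + conformal invariance,
`SLEDomainMarkov.lean`).
-/

noncomputable section

open Literature.Probability.RandomPlanarGeometry

namespace Summit.CriticalPhenomena.CardyFormulaZ2.Theorems.CardyRotToConfR2SymmetryUpgrade

/-- **S5.** Every family of chordal SLE₆ laws on Dobrushin domains is domain Markov
(`ChordalFamily.IsDomainMarkov`), with Markov extension the SLE Markov kernel `sleMarkovKernel 6`.
[cite: Werner2007, §3.2] -/
theorem stub_isDomainMarkov : ∀ Q : ChordalFamily, (∀ D : DobrushinDomain, IsSLELaw 6 D (Q D)) → Q.IsDomainMarkov :=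
  fun _ hQ ↦ ChordalFamily.isDomainMarkov_of_isSLELaw (by norm_num) hQ

end Summit.CriticalPhenomena.CardyFormulaZ2.Theorems.CardyRotToConfR2SymmetryUpgrade

end
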